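import Mathlib.Tactic
import Literature.Probability.LatticeModels.StrassenHolleyCoupling
import HarnessLib

/-!
# Kozma–Nitzan's Question 8 at three relays — THEOREM N1: the level-1 density of the C3 pair is ancestor-transport feasible (gen 25)

Support file (`--supports stmt-CriticalPhenomena-4575`, closed crux; independent mathematics on Kozma–Nitzan's Question 8,
arXiv:2401.12397 §5.5 p. 36), prover `prim-ineq-gen-6` (gen 25).  No definitions, no named facts, no sorries; standard axioms.
Memo `run/shared/lean/prim/prim-ineq-gen-6/PROOF-N1-G25.md`.

SETTING.  For a path-end block `T` the configurations form a finite preorder (ROOT GROWTH: `ζ ≤ ζ'` iff `ζ'` is obtained from `ζ` by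
letting the root run absorb whole fragments, i.e. `ζ'` is an ancestor of `ζ` in the configuration tree), carrying the probability weight
`λ̃` and the class functions `α̂, γ̂, μ̂, ν̂` (hats) with means `ε, π, m, n̄`; `Φ = π+ε−m`, `σ = π+m`, `D = ε−m = Φ−π ≥ 0`.  The level-1
density of the C3 pair is `x = Φσ − Φσ·α̂ − (Φ+m)·γ̂ + (Φ+m+Φσ)·μ̂ − Φσ·ν̂`, and N1 (PROOF-QSPLIT-G23 §2) asks that `Σ_{ζ∈U} λ̃(ζ)x(ζ) ≥ 0`
for every up-set `U` ("ancestor-transport feasible").  THEOREM N1 (memo): with `A = A_[0,k]`, `C = C_[0,k]`, `p = p_k` the hats are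
`(pA, pC, pAC, AC)` and
   `x = (1−A)·f + g`,  `f := mD + (Φ+m)(π − γ̂)`,  `g := Φσ·A(1−p)(1−C) ≥ 0`     (`levelOne_density_decomposition`, a ring identity);
`f` has nonnegative `λ̃`-mass on every up-set because `mD ≥ 0` and `γ̂` is SUB-MEAN on root-growth up-sets ((K-c), THEOREM A of gen 19,
PROOF-KHAT-TREES-G19 §7); the weight `1−A_[0,k]` is nonnegative and MONOTONE (an ancestor has a longer root run, hence a smaller product
`A_[0,k]`); so the layer-cake lemma of the Literature (`sum_mul_nonneg_of_upperSets`, restricted to an up-set) gives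
`Σ_U λ̃(1−A)f ≥ 0`, and `g ≥ 0` pointwise finishes.  Below: the abstract order-theoretic core (`upperSets_nonneg_restrict`,
`upperSets_nonneg_mul_monotone`, `upperSets_nonneg_of_monotone_decomposition`) and the ring identity.  COROLLARY (memo): THEOREM
(T⁺)-C3-PATH-END (gen 21, 14 Bernstein certificates) follows without certificates, since an ancestor transport realises `Ψ¹_T ≽ 0`.
[cite: KozmaNitzan2024, Question 8 (§5.5 p. 36)]
-/

namespace Summit.CriticalPhenomena.PercolationContinuityZ3.Theorems

namespace PocketCert

open Finset

/-- Restricting a weight with nonnegative mass on every up-set to a fixed up-set `U` (zero outside) keeps nonnegative mass on every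
up-set: the mass of an up-set `V` is the mass of the up-set `V ∩ U`. [cite: KozmaNitzan2024, Question 8 (§5.5 p. 36)] -/
theorem upperSets_nonneg_restrict {α : Type*} [Preorder α] [DecidableEq α] (w : α → ℝ)
    (hw : ∀ U : Finset α, IsUpperSet (U : Set α) → 0 ≤ ∑ z ∈ U, w z)
    (U : Finset α) (hU : IsUpperSet (U : Set α)) :
    ∀ V : Finset α, IsUpperSet (V : Set α) → 0 ≤ ∑ z ∈ V, (if z ∈ U then w z else 0) := by
  intro V hV
  rw [Finset.sum_ite_mem]
  apply hw
  intro a b hab ha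
  simp only [coe_inter, Set.mem_inter_iff, mem_coe] at ha ⊢
  exact ⟨hV hab ha.1, hU hab ha.2⟩

/-- **Layer cake on an up-set.**  If `w` has nonnegative mass on every up-set of a finite preorder and `φ ≥ 0` is monotone, then
`Σ_{z∈U} w z · φ z ≥ 0` for every up-set `U` (apply the Literature's layer-cake lemma to `w` restricted to `U`).  This is the step
"an ancestor-transport-feasible class function times a nonnegative weight that does not decrease from child to parent is again
ancestor-transport feasible". [cite: KozmaNitzan2024, Question 8 (§5.5 p. 36)] -/
theorem upperSets_nonneg_mul_monotone {α : Type*} [Fintype α] [Preorder α] (w φ : α → ℝ)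
    (hw : ∀ U : Finset α, IsUpperSet (U : Set α) → 0 ≤ ∑ z ∈ U, w z)
    (hφ0 : ∀ z, 0 ≤ φ z) (hφ : Monotone φ) :
    ∀ U : Finset α, IsUpperSet (U : Set α) → 0 ≤ ∑ z ∈ U, w z * φ z := by
  classical
  intro U hU
  have h := Literature.Probability.LatticeModels.sum_mul_nonneg_of_upperSets
    (fun z => if z ∈ U then w z else 0) φ (upperSets_nonneg_restrict w hw U hU) hφ0 hφ
  have hrw : ∑ z, (if z ∈ U then w z else 0) * φ z = ∑ z ∈ U, w z * φ z := by
    have : ∀ z, (if z ∈ U then w z else 0) * φ z = if z ∈ U then w z * φ z else 0 := by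
      intro z; split_ifs <;> simp
    simp_rw [this]
    rw [Finset.sum_ite_mem, Finset.univ_inter]
  rw [hrw] at h
  exact h

/-- **THEOREM N1, abstract core.**  Let `w ≥ 0` be a weight (`λ̃`), and let the class function `x` decompose as `x = φ·f + g` with
`w·f` of nonnegative mass on every up-set (`f = mD + (Φ+m)(π−γ̂)`: a nonnegative constant plus a sub-mean deficit), `φ ≥ 0` monotone
(`φ = 1 − A_[0,k]`) and `g ≥ 0` pointwise.  Then `w·x` has nonnegative mass on every up-set, i.e. `x` is ancestor-transport feasible.
[cite: KozmaNitzan2024, Question 8 (§5.5 p. 36)] -/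
theorem upperSets_nonneg_of_monotone_decomposition {α : Type*} [Fintype α] [Preorder α] (w x f g φ : α → ℝ)
    (hw0 : ∀ z, 0 ≤ w z)
    (hx : ∀ z, x z = φ z * f z + g z)
    (hf : ∀ U : Finset α, IsUpperSet (U : Set α) → 0 ≤ ∑ z ∈ U, w z * f z)
    (hφ0 : ∀ z, 0 ≤ φ z) (hφ : Monotone φ) (hg : ∀ z, 0 ≤ g z) :
    ∀ U : Finset α, IsUpperSet (U : Set α) → 0 ≤ ∑ z ∈ U, w z * x z := by
  intro U hU
  have h1 := upperSets_nonneg_mul_monotone (fun z => w z * f z) φ hf hφ0 hφ U hU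
  have h2 : 0 ≤ ∑ z ∈ U, w z * g z := Finset.sum_nonneg fun z _ => mul_nonneg (hw0 z) (hg z)
  have : ∑ z ∈ U, w z * x z = ∑ z ∈ U, w z * f z * φ z + ∑ z ∈ U, w z * g z := by
    rw [← Finset.sum_add_distrib]
    refine Finset.sum_congr rfl fun z _ => ?_
    rw [hx z]; ring
  rw [this]
  exact add_nonneg h1 h2

/-- **A sufficient condition for the up-set hypothesis on `f`.**  If `f = a + b·(π̄ − γ)` with constants `a, b ≥ 0` and `γ` SUB-MEAN
for `w` on up-sets (`Σ_U w·(π̄ − γ) ≥ 0`, e.g. (K-c) with `π̄ = π`), and `w ≥ 0`, then `w·f` has nonnegative mass on every up-set.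
[cite: KozmaNitzan2024, Question 8 (§5.5 p. 36)] -/
theorem upperSets_nonneg_const_add_submean {α : Type*} [Preorder α] (w γ : α → ℝ) (a b πbar : ℝ) (hw0 : ∀ z, 0 ≤ w z)
    (ha : 0 ≤ a) (hb : 0 ≤ b)
    (hγ : ∀ U : Finset α, IsUpperSet (U : Set α) → 0 ≤ ∑ z ∈ U, w z * (πbar - γ z)) :
    ∀ U : Finset α, IsUpperSet (U : Set α) → 0 ≤ ∑ z ∈ U, w z * (a + b * (πbar - γ z)) := by
  intro U hU
  have h1 : 0 ≤ ∑ z ∈ U, w z * a := Finset.sum_nonneg fun z _ => mul_nonneg (hw0 z) ha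
  have h2 : 0 ≤ b * ∑ z ∈ U, w z * (πbar - γ z) := mul_nonneg hb (hγ U hU)
  have : ∑ z ∈ U, w z * (a + b * (πbar - γ z)) = ∑ z ∈ U, w z * a + b * ∑ z ∈ U, w z * (πbar - γ z) := by
    rw [Finset.mul_sum, ← Finset.sum_add_distrib]
    refine Finset.sum_congr rfl fun z _ => ?_
    ring
  rw [this]
  exact add_nonneg h1 h2

/-- **The ring identity behind THEOREM N1.**  With `σ = π + m`, `D = Φ − π` (i.e. `Φ = π + ε − m`, `D = ε − m`) and the hats of a class
`(α̂, γ̂, μ̂, ν̂) = (pA, pC, pAC, AC)`, the level-1 density `x = Φσ − Φσ·α̂ − (Φ+m)·γ̂ + (Φ+m+Φσ)·μ̂ − Φσ·ν̂` equals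
`(1 − A)·(m·D + (Φ+m)(π − pC)) + Φσ·A(1−p)(1−C)`. [cite: KozmaNitzan2024, Question 8 (§5.5 p. 36)] -/
theorem levelOne_density_decomposition (Φ π m p A C : ℝ) :
    Φ * (π + m) - Φ * (π + m) * (p * A) - (Φ + m) * (p * C) + (Φ + m + Φ * (π + m)) * (p * A * C) - Φ * (π + m) * (A * C)
      = (1 - A) * (m * (Φ - π) + (Φ + m) * (π - p * C)) + Φ * (π + m) * (A * (1 - p) * (1 - C)) := by
  ring

/-- **Sign facts used by THEOREM N1.**  For parameters in `[0,1]`: the pointwise term `g = Φσ·A(1−p)(1−C)` is nonnegative when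
`Φ, σ ≥ 0`, and the constant `mD` is nonnegative when `m, D ≥ 0`. [cite: KozmaNitzan2024, Question 8 (§5.5 p. 36)] -/
theorem levelOne_pointwise_nonneg (Φ σ m D p A C : ℝ) (hΦ : 0 ≤ Φ) (hσ : 0 ≤ σ) (hm : 0 ≤ m) (hD : 0 ≤ D)
    (hA : 0 ≤ A) (hp : p ≤ 1) (hC : C ≤ 1) :
    0 ≤ Φ * σ * (A * (1 - p) * (1 - C)) ∧ 0 ≤ m * D := by
  refine ⟨?_, mul_nonneg hm hD⟩
  have h1 : 0 ≤ 1 - p := by linarith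
  have h2 : 0 ≤ 1 - C := by linarith
  positivity

end PocketCert

end Summit.CriticalPhenomena.PercolationContinuityZ3.Theorems
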